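import Summits.RiemannHypothesis.RiemannHypothesis.Theorems.SignConeOscillatory.Negative.WithoutNodeNonneg
import Literature.NumberTheory.LFunctions.WeilGroundEnergyProofs

/-!
# `SignConeOscillatory` (crux stmt-RiemannHypothesis-16302) — negative lemma: without the node signs NO slack suffices

Crux-disprover record (seat `refuter-cdisprove-stmt-RiemannHypothesis-16302-0`), sequel of
`Negative/WithoutNodeNonneg.lean` (`signConeOscillatory_false_without_nodeNonneg`: the crux with its node
hypothesis deleted is false). Here the unit slack `-Re F(0)` of the conclusion is replaced by an ARBITRARY multiple
`-C·Re F(0)` and the node hypothesis is still deleted: false for every real `C`. So a planner repair of the form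
"weaken the conclusion to `Re W_ar(F) ≥ -C Re F(0)`" cannot trade away the node signs — on the hn-free cone the
prime-free functional `W_ar` is unbounded below relative to `F(0)` (the antisymmetric far pair of
`WithoutNodeNonneg.lean`: polar term `-8 sinh²(c/4) φ̂(0)φ̂(1)`, archimedean integral bounded, `F(0) ≤ 4‖φ‖₂²`).

* `signConeOscillatory_false_without_nodeNonneg_anySlack` — for every `C : ℝ`, the crux with the node hypothesis
  deleted and conclusion `-C·Re F(0) ≤ Re W_ar(F)` (all else verbatim) is FALSE.
-/

noncomputable section

-- `Summit.RiemannHypothesis.RiemannHypothesis.…` repeats a namespace component by design (D-0017 layout).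
set_option linter.dupNamespace false

open scoped BigOperators ComplexConjugate Topology
open Complex MeasureTheory Set Filter

namespace Summit.RiemannHypothesis.RiemannHypothesis.Theorems.SignConeOscillatory.Negative

open Literature.NumberTheory.LFunctions
open Literature.Analysis.SpecialFunctions
open Summit.RiemannHypothesis.RiemannHypothesis.Theorems.SignCone

/-- `‖w_c‖₂² ≤ 4 ‖φ‖₂²` for the two-bump test `w_c = φ(· + c/2) - φ(· - c/2)`. [folklore] -/
theorem integral_norm_sq_twoBump_le (N : ℕ) (c : ℝ) :
    (∫ t : ℝ, ‖WeilContinuous.moll N (t + c / 2) - WeilContinuous.moll N (t - c / 2)‖ ^ 2) ≤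
      4 * ∫ t : ℝ, ‖WeilContinuous.moll N t‖ ^ 2 := by
  have hφ : IsWeilTest (WeilContinuous.moll N) := WeilContinuous.isWeilTest_moll N
  have hw : IsWeilTest (fun u => WeilContinuous.moll N (u + c / 2) - WeilContinuous.moll N (u - c / 2)) :=
    isWeilTest_twoBump N c
  have h1 : IsWeilTest (fun u => WeilContinuous.moll N (u + c / 2)) := isWeilTest_translate hφ (c / 2)
  have h2 : IsWeilTest (fun u => WeilContinuous.moll N (u - c / 2)) := by
    have := isWeilTest_translate hφ (-(c / 2))
    simpa only [← sub_eq_add_neg] using this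
  have e1 : (∫ t : ℝ, ‖WeilContinuous.moll N (t + c / 2)‖ ^ 2) = ∫ t : ℝ, ‖WeilContinuous.moll N t‖ ^ 2 :=
    integral_norm_sq_translate _ _
  have e2 : (∫ t : ℝ, ‖WeilContinuous.moll N (t - c / 2)‖ ^ 2) = ∫ t : ℝ, ‖WeilContinuous.moll N t‖ ^ 2 := by
    have := integral_norm_sq_translate (WeilContinuous.moll N) (-(c / 2))
    simpa only [← sub_eq_add_neg] using this
  calc (∫ t : ℝ, ‖WeilContinuous.moll N (t + c / 2) - WeilContinuous.moll N (t - c / 2)‖ ^ 2)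
      ≤ ∫ t : ℝ, (2 * ‖WeilContinuous.moll N (t + c / 2)‖ ^ 2 + 2 * ‖WeilContinuous.moll N (t - c / 2)‖ ^ 2) := by
        refine integral_mono hw.integrable_norm_sq
          ((h1.integrable_norm_sq.const_mul 2).add (h2.integrable_norm_sq.const_mul 2)) fun t => ?_
        have := norm_sub_le (WeilContinuous.moll N (t + c / 2)) (WeilContinuous.moll N (t - c / 2))
        have hsq : ‖WeilContinuous.moll N (t + c / 2) - WeilContinuous.moll N (t - c / 2)‖ ^ 2 ≤
            (‖WeilContinuous.moll N (t + c / 2)‖ + ‖WeilContinuous.moll N (t - c / 2)‖) ^ 2 :=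
          pow_le_pow_left₀ (norm_nonneg _) this 2
        nlinarith [hsq, sq_nonneg (‖WeilContinuous.moll N (t + c / 2)‖ - ‖WeilContinuous.moll N (t - c / 2)‖)]
    _ = 4 * ∫ t : ℝ, ‖WeilContinuous.moll N t‖ ^ 2 := by
        rw [integral_add (h1.integrable_norm_sq.const_mul 2) (h2.integrable_norm_sq.const_mul 2),
          integral_const_mul, integral_const_mul, e1, e2]
        ring

/-- **The antisymmetric far pair beats any slack.** For every `C : ℝ` there is `c ≥ 4` such that the two-bump
test `w_c = φ(· + c/2) - φ(· - c/2)` (`φ = WeilContinuous.moll 0`) has `Re W_ar(w_c ⋆ w̃_c) < -C · Re (w_c ⋆ w̃_c)(0)`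
(`c = 4(1 + K)`, `K = max 0 ((D/2π + 4|C| ‖φ‖₂²)/P)`, `P = 8 φ̂(0) φ̂(1)`, `D` the `c`-free archimedean bound). [folklore] -/
theorem exists_twoBump_re_weilArchPolar_lt (C : ℝ) :
    ∃ c : ℝ, 4 ≤ c ∧
      (weilPolarTerm (weilConv (fun u => WeilContinuous.moll 0 (u + c / 2) - WeilContinuous.moll 0 (u - c / 2))
          (weilReflect (fun u => WeilContinuous.moll 0 (u + c / 2) - WeilContinuous.moll 0 (u - c / 2)))) +
        weilArchTerm (weilConv (fun u => WeilContinuous.moll 0 (u + c / 2) - WeilContinuous.moll 0 (u - c / 2))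
          (weilReflect (fun u => WeilContinuous.moll 0 (u + c / 2) - WeilContinuous.moll 0 (u - c / 2))))).re <
      -(C * (weilConv (fun u => WeilContinuous.moll 0 (u + c / 2) - WeilContinuous.moll 0 (u - c / 2))
          (weilReflect (fun u => WeilContinuous.moll 0 (u + c / 2) - WeilContinuous.moll 0 (u - c / 2))) 0).re) := by
  -- the `c`-free constants
  set I0 : ℝ := ∫ t : ℝ, (WeilContinuous.bump 0).normed volume t * Real.exp (-(t / 2)) with hI0
  set I1 : ℝ := ∫ t : ℝ, (WeilContinuous.bump 0).normed volume t * Real.exp (t / 2) with hI1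
  have hI0pos : 0 < I0 := by
    have := integral_bump_normed_mul_exp_pos 0 (-(1 / 2))
    rw [hI0]; convert this using 3; ring_nf
  have hI1pos : 0 < I1 := by
    have := integral_bump_normed_mul_exp_pos 0 (1 / 2)
    rw [hI1]; convert this using 3; ring_nf
  set P : ℝ := 8 * I0 * I1 with hP
  have hPpos : 0 < P := by positivity
  set D : ℝ := 4 * (∫ t : ℝ, ‖weilMellin (WeilContinuous.moll 0) (1 / 2 + t * I)‖ ^ 2 *
      (reDigammaQuarter t - reDigammaQuarter 0)) +
    4 * |reDigammaQuarter 0| * ∫ t : ℝ, ‖weilMellin (WeilContinuous.moll 0) (1 / 2 + t * I)‖ ^ 2 with hD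
  set N2 : ℝ := ∫ t : ℝ, ‖WeilContinuous.moll 0 t‖ ^ 2 with hN2
  have hN2nn : 0 ≤ N2 := integral_nonneg fun t => sq_nonneg _
  set K : ℝ := max 0 ((D / (2 * Real.pi) + 4 * |C| * N2) / P) with hK
  have hK0 : 0 ≤ K := le_max_left _ _
  have hKD : D / (2 * Real.pi) + 4 * |C| * N2 ≤ P * K := by
    have h1 : (D / (2 * Real.pi) + 4 * |C| * N2) / P ≤ K := le_max_right _ _
    have h2 : P * ((D / (2 * Real.pi) + 4 * |C| * N2) / P) = D / (2 * Real.pi) + 4 * |C| * N2 := by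
      field_simp
    calc D / (2 * Real.pi) + 4 * |C| * N2 = P * ((D / (2 * Real.pi) + 4 * |C| * N2) / P) := h2.symm
      _ ≤ P * K := mul_le_mul_of_nonneg_left h1 hPpos.le
  set c : ℝ := 4 * (1 + K) with hc
  have hc4 : 4 ≤ c := by rw [hc]; linarith
  have hsinh : 1 + K ≤ Real.sinh (c / 4) := by
    rw [show c / 4 = 1 + K by rw [hc]; ring]
    exact Real.self_le_sinh_iff.2 (by linarith)
  have hkey_ineq : D / (2 * Real.pi) + 4 * |C| * N2 < P * Real.sinh (c / 4) ^ 2 := by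
    have h1 : (1 + K) ^ 2 ≤ Real.sinh (c / 4) ^ 2 := pow_le_pow_left₀ (by linarith) hsinh 2
    have h2 : K < (1 + K) ^ 2 := by nlinarith
    nlinarith
  refine ⟨c, hc4, ?_⟩
  -- the witness
  set w : ℝ → ℂ := fun u => WeilContinuous.moll 0 (u + c / 2) - WeilContinuous.moll 0 (u - c / 2) with hw_def
  have hw : IsWeilTest w := isWeilTest_twoBump 0 c
  set G : ℝ → ℂ := weilConv w (weilReflect w) with hG_def
  -- the three terms
  have hG0 : G 0 = ((∫ t : ℝ, ‖w t‖ ^ 2 : ℝ) : ℂ) := weilConv_weilReflect_apply_zero w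
  have hG0nn : 0 ≤ (G 0).re := by
    rw [hG0, Complex.ofReal_re]
    exact integral_nonneg fun t => sq_nonneg _
  have hG0le : (G 0).re ≤ 4 * N2 := by
    rw [hG0, Complex.ofReal_re]
    exact integral_norm_sq_twoBump_le 0 c
  have hpol : (weilPolarTerm G).re = -8 * Real.sinh (c / 4) ^ 2 * I0 * I1 := re_weilPolarTerm_twoBump 0 c
  have hAI : weilArchIntegral G = ((∫ t : ℝ, ‖weilMellin w (1 / 2 + t * I)‖ ^ 2 * reDigammaQuarter t : ℝ) : ℂ) :=
    weilArchIntegral_weilConv_weilReflect hw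
  have hAIle : (∫ t : ℝ, ‖weilMellin w (1 / 2 + t * I)‖ ^ 2 * reDigammaQuarter t) ≤ D :=
    weilArchIntegral_twoBump_le 0 c
  have harch : (weilArchTerm G).re =
      1 / (2 * Real.pi) * (∫ t : ℝ, ‖weilMellin w (1 / 2 + t * I)‖ ^ 2 * reDigammaQuarter t) -
        (G 0).re * Real.log Real.pi := by
    unfold weilArchTerm
    rw [hAI, hG0]
    have e : (1 / (2 * Real.pi) : ℂ) = ((1 / (2 * Real.pi) : ℝ) : ℂ) := by push_cast; ring
    rw [e, ← Complex.ofReal_mul, ← Complex.ofReal_mul, ← Complex.ofReal_sub, Complex.ofReal_re,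
      Complex.ofReal_re]
  -- assemble
  have hlogpi := one_le_log_pi
  have hpi : 0 < 2 * Real.pi := by positivity
  rw [Complex.add_re, hpol, harch]
  have h3 : 1 / (2 * Real.pi) * (∫ t : ℝ, ‖weilMellin w (1 / 2 + t * I)‖ ^ 2 * reDigammaQuarter t) ≤
      D / (2 * Real.pi) := by
    rw [div_eq_mul_one_div D, mul_comm D]
    exact mul_le_mul_of_nonneg_left hAIle (by positivity)
  have h4 : 0 ≤ (G 0).re * Real.log Real.pi := mul_nonneg hG0nn (by linarith)
  have h5 : C * (G 0).re ≤ |C| * (4 * N2) := by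
    calc C * (G 0).re ≤ |C| * (G 0).re := mul_le_mul_of_nonneg_right (le_abs_self C) hG0nn
      _ ≤ |C| * (4 * N2) := mul_le_mul_of_nonneg_left hG0le (abs_nonneg C)
  nlinarith [hkey_ineq, h3, h4, h5, hG0nn, sq_nonneg (Real.sinh (c / 4)), hI0pos, hI1pos]

/-- **Without the node signs no slack suffices.** For every `C : ℝ`, the crux `SignConeOscillatory` with its node
hypothesis `∀ n ≥ 2, 0 ≤ Re F(log n)` deleted and the unit slack `-Re F(0)` of its conclusion replaced by
`-C·Re F(0)` (everything else verbatim) is false (witness `k = 1`, `g = w_c` of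
`exists_twoBump_re_weilArchPolar_lt`, cutoff `a = c/2 + 1`; `C = 1` is `signConeOscillatory_false_without_nodeNonneg`).
[folklore] -/
theorem signConeOscillatory_false_without_nodeNonneg_anySlack (C : ℝ) :
    ¬ (∀ a : ℝ, 0 < a → ∀ (k : ℕ) (g : Fin k → ℝ → ℂ), (∀ i, (ContDiff ℝ ((⊤ : ℕ∞) : WithTop ℕ∞) (g i) ∧ HasCompactSupport (g i)) ∧ tsupport (g i) ⊆ Set.Icc (-a) a) → let F : ℝ → ℂ := fun t => ∑ i, MeasureTheory.convolution (g i) (fun u => (starRingEnd ℂ) ((g i) (-u))) (ContinuousLinearMap.mul ℂ ℂ) MeasureTheory.MeasureSpace.volume t; (∃ t : ℝ, Real.log 2 ≤ |t| ∧ (F t).re < 0) → let M : ℂ → ℂ := fun s => ∫ u : ℝ, F u * Complex.exp ((s - 1 / 2) * u); -(C * (F 0).re) ≤ (M 0 + M 1 + ((1 / (2 * Real.pi) : ℂ) * (∫ t : ℝ, M (1 / 2 + t * Complex.I) * ((Complex.digamma (1 / 4 + t / 2 * Complex.I)).re : ℂ)) - F 0 * (Real.log Real.pi : ℂ))).re)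 := by
  intro h
  obtain ⟨c, hc4, hlt⟩ := exists_twoBump_re_weilArchPolar_lt C
  have hρ : (WeilContinuous.bump 0).rOut = 1 := by rw [WeilContinuous.bump_rOut]; norm_num
  set w : ℝ → ℂ := fun u => WeilContinuous.moll 0 (u + c / 2) - WeilContinuous.moll 0 (u - c / 2) with hw_def
  have hw : IsWeilTest w := isWeilTest_twoBump 0 c
  set G : ℝ → ℂ := weilConv w (weilReflect w) with hG_def
  set g : Fin 1 → ℝ → ℂ := fun _ => w with hg_def
  set F : ℝ → ℂ := fun t => ∑ i, weilConv (g i) (weilReflect (g i)) t with hF_def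
  have hFG : F = G := by
    funext t
    simp [hF_def, hg_def, hG_def]
  have ha : 0 < c / 2 + 1 := by linarith
  have hg : ∀ i, (ContDiff ℝ ((⊤ : ℕ∞) : WithTop ℕ∞) (g i) ∧ HasCompactSupport (g i)) ∧
      tsupport (g i) ⊆ Set.Icc (-(c / 2 + 1)) (c / 2 + 1) := by
    intro i
    refine ⟨hw, ?_⟩
    have := tsupport_twoBump_subset 0 (c := c) (by linarith)
    rwa [hρ] at this
  have hosc : ∃ t : ℝ, Real.log 2 ≤ |t| ∧ (F t).re < 0 := by
    refine ⟨c, ?_, ?_⟩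
    · rw [abs_of_pos (by linarith)]
      linarith [Real.log_two_lt_d9]
    · rw [hFG]
      exact re_weilConv_twoBump_neg 0 (by rw [hρ]; linarith)
  -- the mutated statement at the witness, in the Literature vocabulary (definitional unfolding)
  have key : -(C * (F 0).re) ≤ (weilPolarTerm F + weilArchTerm F).re := h (c / 2 + 1) ha 1 g hg hosc
  rw [hFG] at key
  exact absurd key (not_le.2 hlt)

end Summit.RiemannHypothesis.RiemannHypothesis.Theorems.SignConeOscillatory.Negative

end
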